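import Literature.AnabelianGeometry.SemiGraphs.TemperedReconstructionR0CompatTargetHalvesAt
import Literature.AnabelianGeometry.SemiGraphs.TemperedReconstructionCor39bLocallyFiniteSource
import HarnessLib

/-!
# [SemiAnbd] Corollary 3.9, up to twist, at LOCALLY FINITE pairs — the ASYMMETRIC cell: (a) needs Thm. 3.7
# (iii) at the SOURCE only, (b) at the TARGET only (row «COR39b@LOCFIN-SOURCE-FREE», assembly file)

Mochizuki, *Semi-graphs of anabelioids*, Publ. RIMS **42** (2006), §3, Corollary 3.9 and its proof,
manuscript pp. 42–43 [cite: MochizukiSemiAnbd2006, Cor 3.9 pp.42-43].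

PROOF-ONLY file (abc-iut cell, layer L3, seat abc-iut-L3-t10 gen 8; 0 definitions, no named fact; LF-SGA
cell F-1710 / F-2771).  The per-pair closers of record for Cor. 3.9 up to twist (`cor39UpToTwistAt`,
abc-iut-w4-d080) take Thm. 3.7 (iii) at BOTH graphs, and so did this lineage's symmetric locally finite form
`cor39UpToTwistAt_of_isLocallyFinite` (p455767: the residual (CE) «every compact element is verticial» at
both graphs).  Reading the (a)- and (b)-chains shows each clause uses the deep input on ONE side only; the
other side needs just the two halves of Thm. 3.7 (iv) that hold at every locally finite graph
(abc-iut-w6-d062).  The (b)-side is `TemperedReconstructionCor39bLocallyFiniteSource.lean`; this file adds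
the (a)-side and the assembly:

* `cor39a_upToTwistAt_of_targetHalves` / `…_compatUpToTwistAt_…` — clause (a) at the pair from Thm. 3.7
  (iii) at the SOURCE and the two halves at the TARGET (`isCompatiblyQuasiGeometric_of_compat_of_compactInVerticialAt_source`
  of `TemperedReconstructionR0CompatTargetHalvesAt.lean`, after R1 `compat_of_chartPullbackWith_iso`);
* `cor39a_upToTwistAt_of_isLocallyFinite_target` — **(a) at EVERY LOCALLY FINITE target**, with the
  finite-source specialisation and the instance TARGET `𝒢_θ(p, n)` (`thetaRayFreeProP_cor39a_upToTwistAt_target`);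
* ★ `cor39UpToTwistAt_asymmetric_of_isLocallyFinite` — at a pair of locally finite Cor-3.9 graphs:
  (CE) at `G` ⇒ (a); (CE) at `H` ⇒ (b) with full uniqueness of `F.base`; the symmetric closer of record is
  re-derived verbatim as an `example`.  (CE) at the target is NECESSARY for (b)
  (`not_forall_isLocallyFinite_cor39b`); whether (CE) at the source is necessary for (a) is not decided
  here (no witness is known: a locally open morphism out of a non-(CE) locally finite graph into a (CE) graph
  would be needed).

HONEST FRAMING: OUR rendering at OUR typed objects; outside the [IUTchIII] Cor. 3.12 cone (every print
consumer of Cor. 3.9 has a finite dual graph); nothing asserts abc proved or refuted; typed ≠ proved.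
-/

open CategoryTheory Topology

namespace Literature.AnabelianGeometry.SemiGraphs

namespace ProfiniteSemiGraph

universe u

variable {𝒢 ℋ : ProfiniteSemiGraph.{u}}

/-! ### Cor. 3.9 (a) AT the pair from Thm. 3.7 (iii) at the SOURCE and the two halves at the TARGET -/

/-- **[SemiAnbd] Cor. 3.9, clause (a), at the pair `(G, H)` — a homomorphism induced up to twist by a
locally open `F : G → H` is compatibly quasi-geometric — from Thm. 3.7 (iii) AT THE SOURCE `G` and, at the
target chart, ONLY the two halves (hvm) «verticial ⇒ maximal compact», (hei) «edge-like = intersection of two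
distinct maximal compacts»** (def-free currency of abc-iut-w4-d080: R1 `compat_of_chartPullbackWith_iso` ≫
`isCompatiblyQuasiGeometric_of_compat_of_compactInVerticialAt_source`). [cite: MochizukiSemiAnbd2006, Cor 3.9 p.42] -/
theorem cor39a_upToTwistAt_of_targetHalves (h𝒢iii : CompactInVerticialAt 𝒢) (h𝒢 : Cor39Hypotheses 𝒢)
    (hℋ : Cor39Hypotheses ℋ) (c𝒢 : TemperedPiChart 𝒢) (cℋ : TemperedPiChart ℋ)
    (hvmℋ : ∀ (w : ℋ.graph.Vertex) (K : Subgroup cℋ.G), K ∈ verticialSubgroups cℋ w →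
      IsMaximalCompactSubgroup K)
    (heiℋ : ∀ (f : ℋ.graph.Edge) (L : Subgroup cℋ.G), ℋ.graph.IsClosedEdge f →
      L ∈ edgeLikeSubgroups cℋ f → L ≠ ⊥ →
        ∃ K₁ K₂ : Subgroup cℋ.G, IsMaximalCompactSubgroup K₁ ∧ IsMaximalCompactSubgroup K₂ ∧
          K₁ ≠ K₂ ∧ L = K₁ ⊓ K₂)
    (F : Hom 𝒢 ℋ) (hF : F.IsLocallyOpen) (φ : c𝒢.G →ₜ* cℋ.G)
    (hind : ∃ θ : F.ConjugatorFamily, Nonempty (F.chartPullbackWith θ c𝒢 cℋ ≅ BTemp.res φ)) :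
    IsCompatiblyQuasiGeometric φ := by
  obtain ⟨θ, hθ⟩ := hind
  obtain ⟨hV, hE⟩ := F.compat_of_chartPullbackWith_iso θ c𝒢 cℋ φ hθ
  exact isCompatiblyQuasiGeometric_of_compat_of_compactInVerticialAt_source h𝒢iii h𝒢 hℋ c𝒢 cℋ hvmℋ heiℋ
    F φ hF hV hE

/-- The same in the named currency `Hom.InducesUpToTwist` (clause (a) of abc-iut-w4-d080's
`Cor39CompatUpToTwist` at the pair). [cite: MochizukiSemiAnbd2006, Cor 3.9 p.42] -/
theorem cor39a_compatUpToTwistAt_of_targetHalves (h𝒢iii : CompactInVerticialAt 𝒢)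
    (h𝒢 : Cor39Hypotheses 𝒢) (hℋ : Cor39Hypotheses ℋ) (c𝒢 : TemperedPiChart 𝒢) (cℋ : TemperedPiChart ℋ)
    (hvmℋ : ∀ (w : ℋ.graph.Vertex) (K : Subgroup cℋ.G), K ∈ verticialSubgroups cℋ w →
      IsMaximalCompactSubgroup K)
    (heiℋ : ∀ (f : ℋ.graph.Edge) (L : Subgroup cℋ.G), ℋ.graph.IsClosedEdge f →
      L ∈ edgeLikeSubgroups cℋ f → L ≠ ⊥ →
        ∃ K₁ K₂ : Subgroup cℋ.G, IsMaximalCompactSubgroup K₁ ∧ IsMaximalCompactSubgroup K₂ ∧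
          K₁ ≠ K₂ ∧ L = K₁ ⊓ K₂)
    (F : Hom 𝒢 ℋ) (hF : F.IsLocallyOpen) (φ : c𝒢.G →ₜ* cℋ.G) (hind : F.InducesUpToTwist c𝒢 cℋ φ) :
    IsCompatiblyQuasiGeometric φ :=
  cor39a_upToTwistAt_of_targetHalves h𝒢iii h𝒢 hℋ c𝒢 cℋ hvmℋ heiℋ F hF φ hind

/-! ### Cor. 3.9 (a) at every LOCALLY FINITE target -/

/-- **[SemiAnbd] Cor. 3.9 (a), up to twist, at EVERY LOCALLY FINITE TARGET `H` and every source `G`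
satisfying Thm. 3.7 (iii)** (no Thm. 3.7 (iii)/(iv) at `H`; the two target halves by abc-iut-w6-d062): a
homomorphism induced up to twist by a locally open `F : G → H` is compatibly quasi-geometric.
[cite: MochizukiSemiAnbd2006, Cor 3.9 p.42] -/
theorem cor39a_upToTwistAt_of_isLocallyFinite_target (h𝒢iii : CompactInVerticialAt 𝒢)
    (hlfℋ : ℋ.graph.IsLocallyFinite) (h𝒢 : Cor39Hypotheses 𝒢) (hℋ : Cor39Hypotheses ℋ)
    (c𝒢 : TemperedPiChart 𝒢) (cℋ : TemperedPiChart ℋ) (F : Hom 𝒢 ℋ) (hF : F.IsLocallyOpen)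
    (φ : c𝒢.G →ₜ* cℋ.G)
    (hind : ∃ θ : F.ConjugatorFamily, Nonempty (F.chartPullbackWith θ c𝒢 cℋ ≅ BTemp.res φ)) :
    IsCompatiblyQuasiGeometric φ :=
  cor39a_upToTwistAt_of_targetHalves h𝒢iii h𝒢 hℋ c𝒢 cℋ (hvm_of_isLocallyFinite hℋ.thm37Hypotheses hlfℋ cℋ)
    (hei_of_isLocallyFinite hℋ.thm37Hypotheses hlfℋ cℋ) F hF φ hind

/-- **Cor. 3.9 (a) with a FINITE source and a locally finite target** (Thm. 3.7 (iii) at the source by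
abc-iut-L3-t8's `compactInVerticialAt_of_finiteGraph`): the shape «a finite graph of anabelioids mapping into
an infinite locally finite one». [cite: MochizukiSemiAnbd2006, Cor 3.9 p.42] -/
theorem cor39a_upToTwistAt_of_finite_of_isLocallyFinite [Finite 𝒢.graph.Vertex] [Finite 𝒢.graph.Edge]
    (hlfℋ : ℋ.graph.IsLocallyFinite) (h𝒢 : Cor39Hypotheses 𝒢) (hℋ : Cor39Hypotheses ℋ)
    (c𝒢 : TemperedPiChart 𝒢) (cℋ : TemperedPiChart ℋ) (F : Hom 𝒢 ℋ) (hF : F.IsLocallyOpen)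
    (φ : c𝒢.G →ₜ* cℋ.G)
    (hind : ∃ θ : F.ConjugatorFamily, Nonempty (F.chartPullbackWith θ c𝒢 cℋ ≅ BTemp.res φ)) :
    IsCompatiblyQuasiGeometric φ :=
  cor39a_upToTwistAt_of_isLocallyFinite_target compactInVerticialAt_of_finiteGraph hlfℋ h𝒢 hℋ c𝒢 cℋ F hF
    φ hind

section ThetaRayTarget

variable (p : ℕ) [hp : Fact p.Prime] (n : ℕ → ℕ) {𝒦 : ProfiniteSemiGraph.{0}}

/-- **Cor. 3.9 (a) with TARGET abc-iut-L3-d1's countermodel `𝒢_θ(p, n)`** (locally finite; Cor-3.9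
hypotheses by abc-iut-f-176) and any source satisfying Thm. 3.7 (iii): a homomorphism induced up to twist by
a locally open `F : K → 𝒢_θ` is compatibly quasi-geometric — although Thm. 3.7 (iii)/(iv) fail at `𝒢_θ`.
[cite: MochizukiSemiAnbd2006, Cor 3.9 p.42] -/
theorem thetaRayFreeProP_cor39a_upToTwistAt_target (h𝒦iii : CompactInVerticialAt 𝒦)
    (h𝒦 : Cor39Hypotheses 𝒦) (c𝒦 : TemperedPiChart 𝒦) (c : TemperedPiChart (thetaRayFreeProP p n))
    (F : Hom 𝒦 (thetaRayFreeProP p n)) (hF : F.IsLocallyOpen) (φ : c𝒦.G →ₜ* c.G)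
    (hind : ∃ θ : F.ConjugatorFamily, Nonempty (F.chartPullbackWith θ c𝒦 c ≅ BTemp.res φ)) :
    IsCompatiblyQuasiGeometric φ :=
  cor39a_upToTwistAt_of_isLocallyFinite_target h𝒦iii SemiGraph.ray_isLocallyFinite h𝒦
    (thetaRayFreeProP_cor39Hypotheses p n) c𝒦 c F hF φ hind

end ThetaRayTarget

/-! ### The asymmetric locally finite cell of Cor. 3.9 (up to twist) -/

/-- **[SemiAnbd] Corollary 3.9, up to twist, at a pair of LOCALLY FINITE Cor-3.9 graphs — the ASYMMETRIC
cell**: clause (a) needs the residual (CE) «every compact element is verticial» at the SOURCE only, clause (b)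
(existence, with FULL uniqueness of the underlying morphism of semi-graphs) needs (CE) at the TARGET only.
(The symmetric closer of this lineage, `cor39UpToTwistAt_of_isLocallyFinite` (p455767), took (CE) at both
graphs for both clauses; (CE) at the target is NECESSARY for (b) by `not_forall_isLocallyFinite_cor39b`.)
[cite: MochizukiSemiAnbd2006, Cor 3.9 pp.42-43] -/
theorem cor39UpToTwistAt_asymmetric_of_isLocallyFinite (hlf𝒢 : 𝒢.graph.IsLocallyFinite)
    (hlfℋ : ℋ.graph.IsLocallyFinite) (h𝒢 : Cor39Hypotheses 𝒢) (hℋ : Cor39Hypotheses ℋ)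
    (c𝒢 : TemperedPiChart 𝒢) (cℋ : TemperedPiChart ℋ) :
    ((∀ (c : TemperedPiChart 𝒢) (K : Subgroup c.G), IsCompact (K : Set c.G) →
        ∀ g ∈ K, ∃ (v : 𝒢.graph.Vertex) (H : Subgroup c.G), H ∈ verticialSubgroups c v ∧ g ∈ H) →
      ∀ (F : Hom 𝒢 ℋ), F.IsLocallyOpen → ∀ φ : c𝒢.G →ₜ* cℋ.G,
        (∃ θ : F.ConjugatorFamily, Nonempty (F.chartPullbackWith θ c𝒢 cℋ ≅ BTemp.res φ)) →
          IsCompatiblyQuasiGeometric φ) ∧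
    ((∀ (c : TemperedPiChart ℋ) (K : Subgroup c.G), IsCompact (K : Set c.G) →
        ∀ g ∈ K, ∃ (v : ℋ.graph.Vertex) (H : Subgroup c.G), H ∈ verticialSubgroups c v ∧ g ∈ H) →
      ∀ φ : c𝒢.G →ₜ* cℋ.G, IsCompatiblyQuasiGeometric φ →
        ∃ F : Hom 𝒢 ℋ, F.IsLocallyOpen ∧
          (∃ θ : F.ConjugatorFamily, Nonempty (F.chartPullbackWith θ c𝒢 cℋ ≅ BTemp.res φ)) ∧
          ∀ F' : Hom 𝒢 ℋ, F'.IsLocallyOpen →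
            (∃ θ' : F'.ConjugatorFamily, Nonempty (F'.chartPullbackWith θ' c𝒢 cℋ ≅ BTemp.res φ)) →
              F'.base = F.base) :=
  ⟨fun hce𝒢 F hF φ hind => cor39a_upToTwistAt_of_isLocallyFinite_target
      (compactInVerticialAt_of_forall_mem_of_isLocallyFinite hlf𝒢 hce𝒢) hlfℋ h𝒢 hℋ c𝒢 cℋ F hF φ hind,
    fun hceℋ φ hφ => cor39b_upToTwist_baseAt_of_isLocallyFinite_of_forall_mem hlf𝒢 hlfℋ hceℋ h𝒢 hℋ c𝒢
      cℋ φ hφ⟩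

/-- **Re-derivation of the symmetric closer of record** (statement of `cor39UpToTwistAt_of_isLocallyFinite`,
p455767, verbatim — as an `example`, not a second declaration) from the asymmetric cell: (CE) at both graphs
gives (a) and (b). [cite: MochizukiSemiAnbd2006, Cor 3.9 pp.42-43] -/
example (hlf𝒢 : 𝒢.graph.IsLocallyFinite) (hlfℋ : ℋ.graph.IsLocallyFinite)
    (hce𝒢 : ∀ (c : TemperedPiChart 𝒢) (K : Subgroup c.G), IsCompact (K : Set c.G) →
      ∀ g ∈ K, ∃ (v : 𝒢.graph.Vertex) (H : Subgroup c.G), H ∈ verticialSubgroups c v ∧ g ∈ H)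
    (hceℋ : ∀ (c : TemperedPiChart ℋ) (K : Subgroup c.G), IsCompact (K : Set c.G) →
      ∀ g ∈ K, ∃ (v : ℋ.graph.Vertex) (H : Subgroup c.G), H ∈ verticialSubgroups c v ∧ g ∈ H)
    (h𝒢 : Cor39Hypotheses 𝒢) (hℋ : Cor39Hypotheses ℋ) (c𝒢 : TemperedPiChart 𝒢)
    (cℋ : TemperedPiChart ℋ) :
    (∀ (F : Hom 𝒢 ℋ), F.IsLocallyOpen → ∀ φ : c𝒢.G →ₜ* cℋ.G,
        (∃ θ : F.ConjugatorFamily, Nonempty (F.chartPullbackWith θ c𝒢 cℋ ≅ BTemp.res φ)) →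
          IsCompatiblyQuasiGeometric φ) ∧
      ∀ φ : c𝒢.G →ₜ* cℋ.G, IsCompatiblyQuasiGeometric φ →
        ∃ F : Hom 𝒢 ℋ, F.IsLocallyOpen ∧
          (∃ θ : F.ConjugatorFamily, Nonempty (F.chartPullbackWith θ c𝒢 cℋ ≅ BTemp.res φ)) ∧
          ∀ F' : Hom 𝒢 ℋ, F'.IsLocallyOpen →
            (∃ θ' : F'.ConjugatorFamily, Nonempty (F'.chartPullbackWith θ' c𝒢 cℋ ≅ BTemp.res φ)) →
              F'.base.vertexMap = F.base.vertexMap ∧ F'.base.edgeMap = F.base.edgeMap := by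
  obtain ⟨ha, hb⟩ := cor39UpToTwistAt_asymmetric_of_isLocallyFinite hlf𝒢 hlfℋ h𝒢 hℋ c𝒢 cℋ
  refine ⟨ha hce𝒢, fun φ hφ => ?_⟩
  obtain ⟨F, hF, hind, huniq⟩ := hb hceℋ φ hφ
  exact ⟨F, hF, hind, fun F' hF' hind' =>
    ⟨congrArg SemiGraph.Hom.vertexMap (huniq F' hF' hind'), congrArg SemiGraph.Hom.edgeMap (huniq F' hF' hind')⟩⟩

end ProfiniteSemiGraph

end Literature.AnabelianGeometry.SemiGraphs
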